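import Mathlib.MeasureTheory.Constructions.Polish.Basic
import Mathlib.MeasureTheory.Constructions.Polish.EmbeddingReal
import Mathlib.MeasureTheory.Measure.GiryMonad
import Mathlib.MeasureTheory.Measure.Count
import Mathlib.Data.Finset.Sort
import Literature.Probability.Process.PointStationaryLaw
import HarnessLib

/-!
# Events of finite configurations: permutation-invariant Borel conditions on the atoms are
# Giry-measurable (countable read-out, sorted enumerations, Lusin–Souslin)

A finite (simple) point configuration of a Polish space `α` is encoded, as in
`Literature/Probability/Process/PointStationaryLaw.lean`, by its counting measure
`count.restrict F ∈ Measure α` (`F` finite), the space of configurations carrying the Giry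
σ-algebra generated by the evaluations `μ ↦ μ s`.  The main theorem of this file,
`exists_measurableSet_count_restrict_mem_iff`, is the standard transfer between the two
descriptions of events of finite point processes — as sets of counting measures and as symmetric
sets of atom tuples (folklore; cf. Last–Penrose, *Lectures on the Poisson Process* (2017), §6.1,
measurable enumerations of the points of a point process, and Kechris, *Classical Descriptive Set
Theory*, Thm 15.1, Lusin–Souslin):

> if `Q` is a property of point sets such that, for every `m`, `{y : Fin m → α | Q (range y)}`
> agrees on injective tuples with a Borel subset of `αᵐ`, then there is a Giry-measurable set `B`
> of measures with `count|F ∈ B ↔ Q F` for every finite `F ⊆ α`.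

Proof.  (1) READ-OUT: the countable family of finite intersections `⋂ b ∈ I, b` of basic open
sets (`I : Finset (countableBasis α)`) is a π-system containing `univ` and generating the Borel
σ-algebra, so the counts `I ↦ #(F ∩ ⋂ b ∈ I, b)` determine a finite set `F`
(`eq_of_count_biInter_countableBasis_inter_eq`, uniqueness of finite measures); the tuple read-out
`y ↦ (I ↦ #{i | y i ∈ ⋂ b ∈ I, b})` is measurable (`measurable_tupleCount`).  (2) SORTING along a
measurable injection `f : α → ℝ` (which exists on a standard Borel space,
`MeasureTheory.exists_measurableEmbedding_real`): sortedness `StrictMono (f ∘ y)` is a measurable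
condition, every finite set has exactly one sorted enumeration, so the read-out is injective on
sorted tuples (`injOn_tupleCount_sorted`).  (3) LUSIN–SOUSLIN
(`MeasurableSet.image_of_measurable_injOn`): the read-out image of the Borel set of sorted good
tuples is measurable in the standard Borel space `Finset (countableBasis α) → ℝ≥0∞`, and `B` is its
preimage under the (Giry-measurable) configuration read-out `μ ↦ (I ↦ μ (⋂ b ∈ I, b))`.

Design: `α` is any Polish space with its Borel σ-algebra (the requesting route,
`AtomisticToContinuum/Crystallization/PalmUnimodularRigidity`, uses `ℝ³`); no definitions are
introduced — the read-out family and the tuple read-out are explicit terms.  NOT here: locally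
finite infinite configurations (reduce to a bounded window first, as the requester does), marked
or multiple points.
-/

noncomputable section

open scoped ENNReal
open _root_.MeasureTheory Set Function

namespace Literature.Probability.PointProcesses

/-! ### The countable read-out family `⋂ b ∈ I, b` (`I` a finite set of basic open sets) -/

/-- Finite intersections of basic open sets are open. [folklore] -/
theorem isOpen_biInter_countableBasis {α : Type*} [TopologicalSpace α] [PolishSpace α]
    (I : Finset (TopologicalSpace.countableBasis α)) : IsOpen (⋂ b ∈ I, (b : Set α)) :=
  isOpen_biInter_finset fun b _ => TopologicalSpace.isOpen_of_mem_countableBasis b.2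

/-- Finite intersections of basic open sets are measurable. [folklore] -/
theorem measurableSet_biInter_countableBasis {α : Type*} [TopologicalSpace α] [PolishSpace α]
    [MeasurableSpace α] [BorelSpace α] (I : Finset (TopologicalSpace.countableBasis α)) :
    MeasurableSet (⋂ b ∈ I, (b : Set α)) :=
  (isOpen_biInter_countableBasis I).measurableSet

/-- The read-out family is a π-system (closed under binary intersections). [folklore] -/
theorem isPiSystem_range_biInter_countableBasis {α : Type*} [TopologicalSpace α] [PolishSpace α] :
    IsPiSystem (Set.range fun I : Finset (TopologicalSpace.countableBasis α) => ⋂ b ∈ I, (b : Set α)) := by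
  classical
  rintro _ ⟨I, rfl⟩ _ ⟨J, rfl⟩ -
  exact ⟨I ∪ J, Finset.set_biInter_inter I J _⟩

/-- The read-out family generates the Borel σ-algebra. [folklore] -/
theorem measurableSpace_eq_generateFrom_biInter_countableBasis {α : Type*} [TopologicalSpace α]
    [PolishSpace α] [m : MeasurableSpace α] [BorelSpace α] :
    m = MeasurableSpace.generateFrom
      (Set.range fun I : Finset (TopologicalSpace.countableBasis α) => ⋂ b ∈ I, (b : Set α)) := by
  have hb : m = borel α := BorelSpace.measurable_eq
  refine le_antisymm ?_ (MeasurableSpace.generateFrom_le ?_)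
  · rw [hb, (TopologicalSpace.isBasis_countableBasis α).borel_eq_generateFrom]
    refine MeasurableSpace.generateFrom_le fun b hb => MeasurableSpace.measurableSet_generateFrom ⟨{⟨b, hb⟩}, ?_⟩
    simp
  · rintro _ ⟨I, rfl⟩
    exact measurableSet_biInter_countableBasis I

/-- **Separation.** A finite point set is determined by its counts on the read-out family
(uniqueness of finite measures agreeing on a generating π-system containing `univ`). [folklore] -/
theorem eq_of_count_biInter_countableBasis_inter_eq {α : Type*} [TopologicalSpace α] [PolishSpace α]
    [MeasurableSpace α] [BorelSpace α] {F F' : Set α} (hF : F.Finite)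
    (h : ∀ I : Finset (TopologicalSpace.countableBasis α),
      Measure.count ((⋂ b ∈ I, (b : Set α)) ∩ F) = Measure.count ((⋂ b ∈ I, (b : Set α)) ∩ F')) :
    F = F' := by
  haveI : IsFiniteMeasure ((Measure.count : Measure α).restrict F) := by
    refine ⟨?_⟩
    rw [Measure.restrict_apply MeasurableSet.univ, Set.univ_inter]
    exact Measure.count_apply_lt_top.2 hF
  have heq : (Measure.count : Measure α).restrict F = (Measure.count : Measure α).restrict F' := by
    refine ext_of_generate_finite _ measurableSpace_eq_generateFrom_biInter_countableBasis
      isPiSystem_range_biInter_countableBasis ?_ ?_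
    · rintro _ ⟨I, rfl⟩
      simp only [Measure.restrict_apply (measurableSet_biInter_countableBasis I)]
      exact h I
    · have h0 := h ∅
      simp only [Finset.notMem_empty, Set.iInter_of_empty, Set.iInter_univ, Set.univ_inter] at h0
      rw [Measure.restrict_apply MeasurableSet.univ, Measure.restrict_apply MeasurableSet.univ, Set.univ_inter,
        Set.univ_inter]
      exact h0
  ext x
  rw [← Literature.Probability.Process.count_restrict_singleton_ne_zero_iff F x, heq,
    Literature.Probability.Process.count_restrict_singleton_ne_zero_iff]

/-- The configuration read-out `μ ↦ (I ↦ μ (⋂ b ∈ I, b))` is Giry-measurable. [folklore] -/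
theorem measurable_measureRead {α : Type*} [TopologicalSpace α] [PolishSpace α] [MeasurableSpace α]
    [BorelSpace α] :
    Measurable fun (μ : Measure α) (I : Finset (TopologicalSpace.countableBasis α)) => μ (⋂ b ∈ I, (b : Set α)) :=
  measurable_pi_lambda _ fun I => Measure.measurable_coe (measurableSet_biInter_countableBasis I)

/-! ### Tuples of atoms and their read-out `y ↦ (I ↦ #{i | y i ∈ ⋂ b ∈ I, b})` -/

/-- The tuple read-out (a sum of indicators) is measurable. [folklore] -/
theorem measurable_tupleCount {α : Type*} [TopologicalSpace α] [PolishSpace α] [MeasurableSpace α]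
    [BorelSpace α] (m : ℕ) :
    Measurable fun (y : Fin m → α) (I : Finset (TopologicalSpace.countableBasis α)) =>
      ∑ i, (⋂ b ∈ I, (b : Set α)).indicator (fun _ => (1 : ℝ≥0∞)) (y i) :=
  measurable_pi_lambda _ fun I => Finset.measurable_sum _ fun i _ =>
    (measurable_const.indicator (measurableSet_biInter_countableBasis I)).comp (measurable_pi_apply i)

/-- For an injective tuple the read-out counts the atoms of `count|range y` in each read-out set.
[folklore] -/
theorem count_inter_range_eq_tupleCount {α : Type*} [TopologicalSpace α] [PolishSpace α] [MeasurableSpace α]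
    [BorelSpace α] {m : ℕ} {y : Fin m → α} (hy : Function.Injective y)
    (I : Finset (TopologicalSpace.countableBasis α)) :
    Measure.count ((⋂ b ∈ I, (b : Set α)) ∩ Set.range y) =
      ∑ i, (⋂ b ∈ I, (b : Set α)).indicator (fun _ => (1 : ℝ≥0∞)) (y i) := by
  classical
  have hfin : (y ⁻¹' ⋂ b ∈ I, (b : Set α)).Finite := Set.toFinite _
  rw [← Set.image_preimage_eq_inter_range, Measure.count_injective_image hy, Measure.count_apply_finite _ hfin]
  have hF : hfin.toFinset = Finset.univ.filter fun i => y i ∈ ⋂ b ∈ I, (b : Set α) := by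
    ext i
    simp only [Set.Finite.mem_toFinset, Set.mem_preimage, Finset.mem_filter, Finset.mem_univ, true_and]
  rw [hF, Finset.card_filter, Nat.cast_sum]
  refine Finset.sum_congr rfl fun i _ => ?_
  by_cases h : y i ∈ ⋂ b ∈ I, (b : Set α)
  · rw [if_pos h, Set.indicator_of_mem h, Nat.cast_one]
  · rw [if_neg h, Set.indicator_of_notMem h, Nat.cast_zero]

/-- Two injective tuples with the same read-out have the same range. [folklore] -/
theorem range_eq_of_tupleCount_eq {α : Type*} [TopologicalSpace α] [PolishSpace α] [MeasurableSpace α]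
    [BorelSpace α] {m m' : ℕ} {y : Fin m → α} {y' : Fin m' → α} (hy : Function.Injective y)
    (hy' : Function.Injective y')
    (h : (fun I : Finset (TopologicalSpace.countableBasis α) =>
        ∑ i, (⋂ b ∈ I, (b : Set α)).indicator (fun _ => (1 : ℝ≥0∞)) (y i)) =
      fun I : Finset (TopologicalSpace.countableBasis α) =>
        ∑ i, (⋂ b ∈ I, (b : Set α)).indicator (fun _ => (1 : ℝ≥0∞)) (y' i)) :
    Set.range y = Set.range y' :=
  eq_of_count_biInter_countableBasis_inter_eq (Set.finite_range y) fun I => by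
    rw [count_inter_range_eq_tupleCount hy, count_inter_range_eq_tupleCount hy']
    exact congrFun h I

/-! ### Sorted enumerations along an injection `f : α → ℝ` -/

/-- Sortedness along a measurable key is a measurable condition on tuples. [folklore] -/
theorem measurableSet_sorted {α : Type*} [MeasurableSpace α] {f : α → ℝ} (hf : Measurable f) (m : ℕ) :
    MeasurableSet {y : Fin m → α | StrictMono (f ∘ y)} := by
  have h : {y : Fin m → α | StrictMono (f ∘ y)} =
      ⋂ i : Fin m, ⋂ j : Fin m, ⋂ (_ : i < j), {y : Fin m → α | f (y i) < f (y j)} := by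
    ext y
    simp only [StrictMono, Set.mem_setOf_eq, Set.mem_iInter, Function.comp_apply]
  rw [h]
  exact MeasurableSet.iInter fun i => MeasurableSet.iInter fun j => MeasurableSet.iInter fun _ =>
    measurableSet_lt (hf.comp (measurable_pi_apply i)) (hf.comp (measurable_pi_apply j))

/-- A sorted tuple is injective. [folklore] -/
theorem injective_of_sorted {α : Type*} {f : α → ℝ} {m : ℕ} {y : Fin m → α} (hy : StrictMono (f ∘ y)) :
    Function.Injective y :=
  hy.injective.of_comp

/-- Two sorted tuples (along an injective key) with the same range coincide. [folklore] -/
theorem eq_of_sorted_of_range_eq {α : Type*} {f : α → ℝ} (hf : Function.Injective f) {m : ℕ} {y y' : Fin m → α}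
    (hy : StrictMono (f ∘ y)) (hy' : StrictMono (f ∘ y')) (h : Set.range y = Set.range y') : y = y' := by
  have h1 : f ∘ y = f ∘ y' := (hy.range_inj hy').1 (by rw [Set.range_comp, Set.range_comp, h])
  funext i
  exact hf (congrFun h1 i)

/-- Every finite set has a sorted enumeration along an injective key. [folklore] -/
theorem exists_sorted_enum {α : Type*} {f : α → ℝ} (hf : Function.Injective f) {F : Set α} (hF : F.Finite) :
    ∃ m : ℕ, ∃ y : Fin m → α, StrictMono (f ∘ y) ∧ Set.range y = F := by
  classical
  set G : Finset ℝ := hF.toFinset.image f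
  have hG : ∀ i : Fin G.card, ∃ x ∈ F, f x = G.orderEmbOfFin rfl i := fun i => by
    obtain ⟨x, hx, hxi⟩ := Finset.mem_image.1 (G.orderEmbOfFin_mem rfl i)
    exact ⟨x, hF.mem_toFinset.1 hx, hxi⟩
  choose y hyF hyf using hG
  refine ⟨G.card, y, fun i j hij => ?_, Set.ext fun x => ⟨?_, fun hx => ?_⟩⟩
  · simp only [Function.comp_apply, hyf]
    exact (G.orderEmbOfFin rfl).strictMono hij
  · rintro ⟨i, rfl⟩
    exact hyF i
  · have hm : f x ∈ Set.range (G.orderEmbOfFin rfl) := by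
      rw [Finset.range_orderEmbOfFin]
      exact Finset.mem_coe.2 (Finset.mem_image_of_mem _ (hF.mem_toFinset.2 hx))
    obtain ⟨i, hi⟩ := hm
    exact ⟨i, hf (by rw [hyf, hi])⟩

/-- The tuple read-out is injective on sorted tuples (along an injective key): finite point sets
are separated by the read-out family, and sorted enumerations are unique. [folklore] -/
theorem injOn_tupleCount_sorted {α : Type*} [TopologicalSpace α] [PolishSpace α] [MeasurableSpace α] [BorelSpace α]
    {f : α → ℝ} (hf : Function.Injective f) (m : ℕ) :
    Set.InjOn (fun (y : Fin m → α) (I : Finset (TopologicalSpace.countableBasis α)) =>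
        ∑ i, (⋂ b ∈ I, (b : Set α)).indicator (fun _ => (1 : ℝ≥0∞)) (y i))
      {y : Fin m → α | StrictMono (f ∘ y)} :=
  fun _ hy _ hy' h => eq_of_sorted_of_range_eq hf hy hy'
    (range_eq_of_tupleCount_eq (injective_of_sorted hy) (injective_of_sorted hy') h)

/-! ### The transfer theorem -/

/-- **Permutation-invariant Borel events of finite configurations are Giry-measurable.**  Let `Q` be
a property of point sets of a Polish space `α` such that for every `m` the set of injective
`m`-tuples `y` with `Q (range y)` agrees, on injective tuples, with a Borel subset of `Fin m → α`.
Then there is a measurable set `B` of measures on `α` (Giry σ-algebra) such that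
`count|F ∈ B ↔ Q F` for every finite `F ⊆ α`.  (Read-out through the countable π-system of finite
intersections of basic open sets; sorted enumerations along a Borel injection into `ℝ`; Lusin–Souslin
for the injective read-out of the Borel set of sorted good tuples.) [folklore] -/
theorem exists_measurableSet_count_restrict_mem_iff {α : Type*} [TopologicalSpace α] [PolishSpace α]
    [MeasurableSpace α] [BorelSpace α] {Q : Set α → Prop}
    (hQ : ∀ m : ℕ, ∃ G : Set (Fin m → α), MeasurableSet G ∧
      ∀ y : Fin m → α, Function.Injective y → (Q (Set.range y) ↔ y ∈ G)) :
    ∃ B : Set (Measure α), MeasurableSet B ∧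
      ∀ F : Set α, F.Finite → ((Measure.count : Measure α).restrict F ∈ B ↔ Q F) := by
  classical
  -- a Borel injection into `ℝ` to sort along
  obtain ⟨f, hf⟩ := MeasureTheory.exists_measurableEmbedding_real α
  -- Borel sets of good tuples, cut down to sorted ones
  choose G hGm hG using hQ
  obtain ⟨GT, hGT⟩ : ∃ GT : (m : ℕ) → Set (Fin m → α), ∀ m, GT m = {y : Fin m → α | StrictMono (f ∘ y)} ∩ G m :=
    ⟨_, fun m => rfl⟩
  have hGTm : ∀ m, MeasurableSet (GT m) := fun m => by
    rw [hGT]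
    exact (measurableSet_sorted hf.measurable m).inter (hGm m)
  -- the tuple read-outs and their Lusin–Souslin images
  obtain ⟨θ, hθ⟩ : ∃ θ : (m : ℕ) → (Fin m → α) → Finset (TopologicalSpace.countableBasis α) → ℝ≥0∞, ∀ m, θ m =
      fun (y : Fin m → α) (I : Finset (TopologicalSpace.countableBasis α)) =>
        ∑ i, (⋂ b ∈ I, (b : Set α)).indicator (fun _ => (1 : ℝ≥0∞)) (y i) :=
    ⟨_, fun m => rfl⟩
  have hθinj : ∀ m, Set.InjOn (θ m) (GT m) := fun m => by
    rw [hθ, hGT]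
    exact (injOn_tupleCount_sorted hf.injective m).mono Set.inter_subset_left
  have hE : MeasurableSet (⋃ m, θ m '' GT m) :=
    MeasurableSet.iUnion fun m =>
      (hGTm m).image_of_measurable_injOn (by rw [hθ]; exact measurable_tupleCount m) (hθinj m)
  -- the event
  refine ⟨(fun (μ : Measure α) (I : Finset (TopologicalSpace.countableBasis α)) => μ (⋂ b ∈ I, (b : Set α))) ⁻¹'
      ⋃ m, θ m '' GT m, measurable_measureRead hE, fun F hF => ?_⟩
  obtain ⟨m, y, hys, hyr⟩ := exists_sorted_enum hf.injective hF
  have hyi : Function.Injective y := injective_of_sorted hys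
  have hread : (fun I : Finset (TopologicalSpace.countableBasis α) =>
      (Measure.count : Measure α).restrict F (⋂ b ∈ I, (b : Set α))) = θ m y := by
    rw [hθ]
    funext I
    rw [Measure.restrict_apply (measurableSet_biInter_countableBasis I), ← hyr]
    exact count_inter_range_eq_tupleCount hyi I
  rw [Set.mem_preimage, hread, Set.mem_iUnion, ← hyr]
  constructor
  · rintro ⟨m', y', hy', hEq⟩
    rw [hGT] at hy'
    obtain ⟨hs', hg'⟩ := hy'
    have hrange : Set.range y' = Set.range y := by
      refine range_eq_of_tupleCount_eq (injective_of_sorted hs') hyi ?_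
      have h' := hEq
      rw [hθ, hθ] at h'
      exact h'
    rw [← hrange]
    exact (hG m' y' (injective_of_sorted hs')).2 hg'
  · intro hq
    refine ⟨m, y, ?_, rfl⟩
    rw [hGT]
    exact ⟨hys, (hG m y hyi).1 hq⟩

end Literature.Probability.PointProcesses

end
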